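import Literature.NumberTheory.EllipticCurves.Kato2004.Condition1252
import Literature.NumberTheory.EllipticCurves.BSDSelmerPConverseUnipotentProofs
import Literature.NumberTheory.EllipticCurves.Rank1Residual.Predicates
import HarnessLib

/-!
# surj(p) ∧ (im) ⟹ the whole `p`-adic tower; hence on the EXOTIC rows at `3` (surj(3) ∧ ¬surj(9))
# hypothesis (im) itself FAILS — the exact failing hypothesis of every Kolyvagin-system route
# (cell `b2b-bsdres`, team n1011, sub-target T-a5 (i); §I items N11 / O8)

HONEST FRAMING (cell `b2b-bsdres`, run/shared/lean/b2b/bsd-rank1-residual/, verbatim in every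
file): the goal of the cell is to DELETE the COMBINATION-SHAPED residual classes of the
Birch–Swinnerton-Dyer formula for ALL analytic-rank `≤ 1` elliptic curves over `ℚ` — "full BSD
formula for every rank `≤ 1` curve in class `C`" assembled STRICTLY from published theorems — so
that the rank-`≤ 1` remainder becomes exactly the CONSTRUCTION-SHAPED classes, which are TYPED
(missing-input `Prop`s), NOT attempted. This is not "finishing BSD". Team n1011: prove what is
provable now; shrink each hard class to its core with data; no claim beyond stated classes. Theorems
only (no definition, no named fact); nothing is booked; no label changes. A NO-GO about the
hypotheses of printed theorems on one corner of N11, and a positive tower criterion.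

## What and why

The EXOTIC residue of N11 (`x4SharpThree_iff_residue_sharp`, `x4SharpUnitFree_iff_lower_and_residues_sharp`):
X4 pairs `(E, 3)` with `ρ̄_{E,3}` onto but `ρ̄_{E,9}` NOT onto (N. Elkies, arXiv:math/0612734: a
genus-`0` family; S-b sweep `N < 5·10⁵`: 21 curves, three `j`-invariants). There Kato's integrality
hypothesis (12.5.2) `Kato2004.ImageContainsSL2 W 3` fails trivially
(`Kato2004.not_imageContainsSL2_of_not_hasSurjectiveModNGaloisRep`). The printed Euler/Kolyvagin-system
machinery, however, is stated under a WEAKER hypothesis — Kato, Astérisque 295 (2004) Thm. 13.4 (3):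
"there exists `σ ∈ Gal(ℚ̄/ℚ(ζ_{p^∞}))` such that `Coker(1 − σ : T → T)` is a free `O_L`-module of
rank `1`" = Burungale–Castella–Skinner 2025 (im) = Skinner 2016 §2.5 (b) = Rubin's `Hyp(ℚ, T)` (a)
(as quoted by Kim–Nakamura 2020, Assumption 4.1) = the cell predicate `Rank1Residual.BigIm W p`. Could
(im) rescue the EXOTIC rows? **No**:

* `forall_hasSurjectiveModNGaloisRep_pow_of_surj_of_bigIm` — for an odd prime `p`, **surj(p) ∧ (im)
  ⟹ `ρ̄_{E,p^n}` onto for every `n`**. Proof: an (im)-witness `σ` has `det ρ_{E,p}(σ) = χ_p(σ) = 1`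
  (`σ` fixes `μ_{p^∞}`; tree `det_galoisRepTate_eq_cyclotomicCharacter`) and `T_pE/(σ − 1)T_pE ≅ ℤ_p`;
  by Cayley–Hamilton on the free rank-`2` module `T_pE`, `(σ − 1)² = (tr σ − 2)·σ`, and `tr σ − 2`
  kills `T/(σ−1)T ≅ ℤ_p`, so `tr σ = 2` and `(σ − 1)² = 0` on `T_pE`; `σ` does not act trivially on
  `E[p]` (else `(σ−1)T ⊆ pT` and `E[p] = π₁(T_pE)` would be cyclic, contradicting `#E[p] = p²`); so
  `σ` acts on `E[p²]` as a unipotent element moving a point of order `p`, and the tree's transvection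
  form of Serre's lifting lemma (`hasSurjectiveModNGaloisRep_pow_of_unipotent`, valid for EVERY `p`)
  gives surj(p²), whence the tower by `forall_hasSurjectiveModNGaloisRep_of_hasSurjectiveModNGaloisRep_sq`
  (Serre's inductive step, `p` odd).
* `bigIm_iff_imageContainsSL2_of_surj` — for odd `p` under surj(p): **(im) ⟺ (12.5.2)** (the converse
  direction is the tree's `Kato2004.exists_quotient_range_sub_one_equiv_of_imageContainsSL2`). New
  content only at `p = 3` (for `p ≥ 5`, surj(p) alone gives both, Serre).
* `not_bigIm_of_surj_three_of_not_surj_nine`, `not_bigIm_of_surj_three_of_not_towerSurj` — **on every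
  EXOTIC row (im) fails.** So NO route whose integrality rests on such a `σ` — Kato 12.5 (4) / 13.4 (3)
  / 14.5 (3) / 17.4 (3), Skinner–Urban / Skinner 2016 / BCS 2025 integral clauses, Kim–Nakamura 2020
  Thm. 4.2, Mazur–Rubin-type Kolyvagin-system arguments with a transvection `τ`, and the ANNOUNCED
  Kim (arXiv:2505.09121, "large image" `⊇ SL₂(ℤ_p)`) — reaches an EXOTIC row, even after weakening
  "large image" to (im). Per pair these rows close by `3`-Selmer certificates
  (`Additive/X4ThreeSel3Certificate.lean`) or by derived Heegner classes (surj(3) suffices); at class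
  level they are an ideation target shared with O8.

Independent finite check (seat folder `work/mod9_groups.py`, pure python): the proper subgroups of
`GL₂(ℤ/9)` with surjective reduction mod `3` and surjective determinant form ONE conjugacy class of
27 groups of order 144 (`G ∩ (1 + 3M₂) = {I, 4I, 7I}`, `G ∩ SL₂(ℤ/9) ≅ SL₂(𝔽₃)` of exponent 12),
none of which contains a conjugate of `(1 1; 0 1)` — the group-theoretic shadow of the theorem.

References: K. Kato, Astérisque 295 (2004), Thm. 12.5 (4) + (12.5.2) (p. 222), Thm. 13.4 (3)
(p. 226) [Kato2004Asterisque]; A. Burungale, F. Castella, C. Skinner, IMRN 2025, hypothesis (im)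
[BurungaleCastellaSkinner2025]; C. Skinner, Pacific J. Math. 283 (2016) §2.5 (b); C.-H. Kim,
K. Nakamura, J. Number Theory 210 (2020), Assumption 4.1, Thm. 4.2 [KimNakamura2020]; J.-P. Serre,
*Abelian ℓ-adic representations* (1968), IV §3.4 Lemma 3 [SerreAbelianLadic1968]; N. D. Elkies,
arXiv:math/0612734 (2006); C.-H. Kim (app. R. Pollack), arXiv:2505.09121 (2025, PREPRINT).
-/

noncomputable section

open scoped Classical

open WeierstrassCurve Field Literature.NumberTheory.EllipticCurves
  Literature.NumberTheory.EllipticCurves.Rank1Residual Literature.NumberTheory.GaloisRepresentations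

namespace Summit.BirchSwinnertonDyer.Rank1Residual.GaloisImage

variable (W : WeierstrassCurve ℚ) [W.IsElliptic] (p : ℕ) [hp : Fact p.Prime]

/-- Cayley–Hamilton for `2 × 2` matrices over a commutative ring: `M² = tr(M)·M − det(M)·1`.
[folklore] -/
private theorem mat_two_mul_self {R : Type*} [CommRing R] (M : Matrix (Fin 2) (Fin 2) R) :
    M * M = M.trace • M - M.det • (1 : Matrix (Fin 2) (Fin 2) R) := by
  ext i j
  fin_cases i <;> fin_cases j <;>
    simp [Matrix.mul_apply, Fin.sum_univ_two, Matrix.trace_fin_two, Matrix.det_fin_two] <;> ring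

/-- **An (im)-witness is unipotent on `T_pE`.** If `σ ∈ Γ_ℚ` fixes every `p`-power root of unity and
`T_pE/(ρ(σ) − 1)T_pE ≅ ℤ_p`, then `(ρ(σ) − 1)² = 0` on `T_pE`, i.e. `σ • (σ • a − a) = σ • a − a` for
all `a ∈ T_pE` (`det ρ(σ) = χ_p(σ) = 1`, Cayley–Hamilton on the free rank-`2` module `T_pE`, and
`tr ρ(σ) − 2` kills the rank-one free quotient). [cite: Kato2004Asterisque, Thm. 13.4 (3) (p. 226), hypothesis] -/
theorem smul_smul_sub_eq_of_bigImWitness (σ : absoluteGaloisGroup ℚ)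
    (hσ : ∀ (n : ℕ) (t : AlgebraicClosure ℚ), t ^ p ^ n = 1 → σ • t = t)
    (Ψ : ((W.tateModule p) ⧸ LinearMap.range (W.galoisRepTate p σ - LinearMap.id)) ≃ₗ[ℤ_[p]] ℤ_[p])
    (a : W.tateModule p) : σ • (σ • a - a) = σ • a - a := by
  have hpP : p.Prime := hp.out
  have hp0 : (p : ℚ) ≠ 0 := Nat.cast_ne_zero.mpr hpP.ne_zero
  haveI : NeZero (p : ℚ) := ⟨hp0⟩
  haveI : Module.Free ℤ_[p] (W.tateModule p) := module_free_tateModule_holds W p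
  haveI : Module.Finite ℤ_[p] (W.tateModule p) := module_finite_tateModule_holds W p
  have h2 : Module.finrank ℤ_[p] (W.tateModule p) = 2 := finrank_tateModule_eq_two_holds W p hp0
  let bT : Module.Basis (Fin 2) ℤ_[p] (W.tateModule p) := Module.finBasisOfFinrankEq _ _ h2
  set f : W.tateModule p →ₗ[ℤ_[p]] W.tateModule p := W.galoisRepTate p σ with hf
  have hfa : ∀ x, f x = σ • x := fun x => by rw [hf, galoisRepTate_apply_apply]
  -- `det f = χ_p(σ) = 1`
  have hχ : GaloisRep.cyclotomicCharacter ℚ p σ = 1 := by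
    rw [GaloisRep.cyclotomicCharacter_apply]
    exact cyclotomicCharacter_eq_one_of_forall_pow_eq_one p _ fun n t ht => hσ n t ht
  have hdet : LinearMap.det f = 1 := by
    rw [hf, det_galoisRepTate_eq_cyclotomicCharacter W p hp0 (fun n => exists_weilPairing_holds W _) σ,
      hχ, Units.val_one]
  -- Cayley–Hamilton: `f ∘ f = t • f - 1`, `t = tr f`
  set M : Matrix (Fin 2) (Fin 2) ℤ_[p] := LinearMap.toMatrix bT bT f with hM
  have hdetM : M.det = 1 := by rw [hM, LinearMap.det_toMatrix, hdet]
  set t : ℤ_[p] := M.trace with ht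
  have hCH : f * f = t • f - 1 := by
    apply (LinearMap.toMatrix bT bT).injective
    rw [LinearMap.toMatrix_mul, map_sub, map_smul, LinearMap.toMatrix_one, ← hM, mat_two_mul_self M,
      hdetM, one_smul]
  have hCHa : ∀ x, σ • (σ • x) = t • (σ • x) - x := fun x => by
    have h := congrArg (fun g : W.tateModule p →ₗ[ℤ_[p]] W.tateModule p => g x) hCH
    simp only [Module.End.mul_apply, LinearMap.sub_apply, LinearMap.smul_apply,
      Module.End.one_apply, hfa] at h
    exact h
  -- `(t - 2)` kills `T/S`, `S = range (f - id)`
  set S : Submodule ℤ_[p] (W.tateModule p) := LinearMap.range (W.galoisRepTate p σ - LinearMap.id)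
    with hS
  have hmemS : ∀ x, σ • x - x ∈ S := fun x =>
    ⟨x, by rw [LinearMap.sub_apply, galoisRepTate_apply_apply, LinearMap.id_apply]⟩
  have hkill : ∀ x, (t - 2) • x ∈ S := by
    intro x
    have h1 : (t - 2) • (σ • x) ∈ S := by
      have : (t - 2) • (σ • x) = (σ • (σ • x) - σ • x) - (σ • x - x) := by
        rw [hCHa x, sub_smul, two_smul]; abel
      rw [this]
      exact S.sub_mem (hmemS (σ • x)) (hmemS x)
    have h2 : (t - 2) • x = (t - 2) • (σ • x) - (t - 2) • (σ • x - x) := by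
      rw [smul_sub]; abel
    rw [h2]
    exact S.sub_mem h1 (S.smul_mem _ (hmemS x))
  have ht2 : t = 2 := by
    obtain ⟨x₀, hx₀⟩ := Submodule.Quotient.mk_surjective S (Ψ.symm 1)
    have h0 : (t - 2) • (1 : ℤ_[p]) = 0 := by
      have : (t - 2) • Submodule.Quotient.mk (p := S) x₀ = 0 := by
        rw [← Submodule.Quotient.mk_smul, Submodule.Quotient.mk_eq_zero]
        exact hkill x₀
      rw [hx₀, ← map_smul, LinearEquiv.map_eq_zero_iff] at this
      exact this
    rw [smul_eq_mul, mul_one] at h0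
    exact (sub_eq_zero.mp h0)
  -- conclusion
  rw [smul_sub, hCHa a, ht2, two_smul]
  abel

/-- **An (im)-witness moves some point of `E[p]`.** If `σ` fixes every `p`-power root of unity and
`T_pE/(ρ(σ) − 1)T_pE ≅ ℤ_p`, then `σ` does not act trivially on `E[p]`: otherwise `(σ − 1)T_pE ⊆ pT_pE`
and `E[p] = π₁(T_pE)` would be cyclic (generated by the image of a lift of a generator of
`T/(σ − 1)T`), contradicting `#E[p] = p²`. [cite: Kato2004Asterisque, Thm. 13.4 (3) (p. 226), hypothesis]
[cite: SilvermanAEC2009, Cor. III.6.4(b)] -/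
theorem exists_torsion_smul_ne_of_bigImWitness (σ : absoluteGaloisGroup ℚ)
    (Ψ : ((W.tateModule p) ⧸ LinearMap.range (W.galoisRepTate p σ - LinearMap.id)) ≃ₗ[ℤ_[p]] ℤ_[p]) :
    ∃ P : geomTorsion W p, σ • P ≠ P := by
  have hpP : p.Prime := hp.out
  by_contra hall
  have hall' : ∀ P : geomTorsion W p, σ • P = P := fun P => by
    by_contra hP
    exact hall ⟨P, hP⟩
  set S : Submodule ℤ_[p] (W.tateModule p) := LinearMap.range (W.galoisRepTate p σ - LinearMap.id)
    with hS
  -- the first projection `π : T_pE → E[p]`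
  have hmem : ∀ a : W.tateModule p, TateModule.proj p 1 a ∈ geomTorsion W p := fun a => by
    have h := proj_tateModule_mem_geomTorsion W p 1 a
    rwa [pow_one] at h
  set π : W.tateModule p →+ geomTorsion W p :=
    (TateModule.proj p 1).codRestrict (geomTorsion W p) hmem with hπ
  have hπval : ∀ a, (π a : geomPoints W) = TateModule.proj p 1 a := fun a => rfl
  have hπsurj : Function.Surjective π := by
    intro P
    have hP : (P : geomPoints W) ∈ geomTorsion W (p ^ 1 : ℕ) := by rw [pow_one]; exact P.2
    obtain ⟨a, ha⟩ := proj_surjective_of_isAlgClosed_holds W p 1 hP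
    exact ⟨a, Subtype.ext ha⟩
  have hπsmul : ∀ a, π (σ • a) = σ • π a := fun a => Subtype.ext rfl
  have hpE : ∀ e : geomTorsion W p, p • e = 0 := by
    intro e
    apply Subtype.ext
    have he : ((p : ℤ) • (e : geomPoints W)) = 0 := (Submodule.mem_torsionBy_iff _ _).mp e.2
    rw [AddSubmonoidClass.coe_nsmul, ZeroMemClass.coe_zero, ← natCast_zsmul, he]
  -- `S ⊆ ker π` (σ acts trivially on `E[p]`)
  have hSker : ∀ s ∈ S, π s = 0 := by
    rintro s ⟨b, rfl⟩
    rw [LinearMap.sub_apply, galoisRepTate_apply_apply, LinearMap.id_apply, map_sub, hπsmul, hall',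
      sub_self]
  -- `π (p • x) = 0`
  have hπp : ∀ x : W.tateModule p, π ((p : ℤ_[p]) • x) = 0 := by
    intro x
    rw [Nat.cast_smul_eq_nsmul, map_nsmul, hpE]
  -- a lift `t₀` of a generator of `T/S ≅ ℤ_p`; every `a` is `≡ c • t₀ (mod S)`
  obtain ⟨t₀, ht₀⟩ := Submodule.Quotient.mk_surjective S (Ψ.symm 1)
  have hQ1 : ∀ a : W.tateModule p, ∃ c : ℤ_[p], a - c • t₀ ∈ S := by
    intro a
    refine ⟨Ψ (Submodule.Quotient.mk a), (Submodule.Quotient.eq S).mp ?_⟩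
    rw [Submodule.Quotient.mk_smul, ht₀]
    apply Ψ.injective
    rw [map_smul, LinearEquiv.apply_symm_apply, smul_eq_mul, mul_one]
  have hdecomp : ∀ c : ℤ_[p], ∃ (m : ℕ) (c' : ℤ_[p]), c = m + p * c' := by
    intro c
    refine ⟨(PadicInt.toZMod c).val, ?_⟩
    have hk : c - ((PadicInt.toZMod c).val : ℤ_[p]) ∈ RingHom.ker (PadicInt.toZMod (p := p)) := by
      rw [RingHom.mem_ker, map_sub, map_natCast, ZMod.natCast_zmod_val, sub_self]
    rw [PadicInt.ker_toZMod, PadicInt.maximalIdeal_eq_span_p, Ideal.mem_span_singleton] at hk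
    obtain ⟨c', hc'⟩ := hk
    exact ⟨c', by rw [← hc']; abel⟩
  -- `E[p]` is generated by `x₀ = π t₀`
  set x₀ : geomTorsion W p := π t₀ with hx₀
  have hgen : ∀ P : geomTorsion W p, ∃ m : ℕ, P = m • x₀ := by
    intro P
    obtain ⟨a, rfl⟩ := hπsurj P
    obtain ⟨c, hc⟩ := hQ1 a
    obtain ⟨m, c', rfl⟩ := hdecomp c
    refine ⟨m, ?_⟩
    have h1 : π (a - ((m : ℤ_[p]) + p * c') • t₀) = 0 := hSker _ hc
    rw [map_sub, sub_eq_zero, add_smul, map_add, mul_smul, hπp, add_zero, Nat.cast_smul_eq_nsmul,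
      map_nsmul] at h1
    exact h1
  have htop : AddSubgroup.zmultiples x₀ = ⊤ := by
    rw [eq_top_iff]
    intro P _
    obtain ⟨m, rfl⟩ := hgen P
    exact (AddSubgroup.zmultiples x₀).nsmul_mem (AddSubgroup.mem_zmultiples x₀) m
  -- count: `#E[p] = addOrderOf x₀ ∣ p`, but `#E[p] = p²`
  have hcard : Nat.card (geomTorsion W p) = addOrderOf x₀ := by
    rw [← AddSubgroup.card_top, ← htop, Nat.card_zmultiples]
  have hdvd : addOrderOf x₀ ∣ p := addOrderOf_dvd_of_nsmul_eq_zero (hpE x₀)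
  have hp' : (p : AlgebraicClosure ℚ) ≠ 0 := Nat.cast_ne_zero.mpr hpP.ne_zero
  have hE : Nat.card (geomTorsion W p) = p ^ 2 :=
    card_torsionPoints_eq_sq_holds W (AlgebraicClosure ℚ) (n := p) hp'
  have hle : p ^ 2 ≤ p := by
    rw [← hE, hcard]
    exact Nat.le_of_dvd hpP.pos hdvd
  have hlt : p < p ^ 2 := by
    rw [sq]
    exact lt_mul_self hpP.one_lt
  exact absurd hle (not_le.mpr hlt)

/-- **surj(p) ∧ (im) ⟹ `ρ̄_{E,p^n}` onto for every `n` (`p` odd).** For an elliptic curve `E = W/ℚ`,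
an odd prime `p` with `ρ̄_{E,p}` surjective, and hypothesis (im) (`Rank1Residual.BigIm W p`: some
`σ ∈ G_{ℚ(μ_{p^∞})}` with `T_pE/(σ−1)T_pE ≅ ℤ_p` — Kato 2004 Thm. 13.4 (3), BCS 2025 (im), Skinner 2016
§2.5 (b)): every `ρ̄_{E,p^n}` is onto. The (im)-witness acts on `E[p²]` unipotently
(`smul_smul_sub_eq_of_bigImWitness`) and moves a point of order `p`
(`exists_torsion_smul_ne_of_bigImWitness`), so the tree's transvection form of Serre's lifting lemma
(`hasSurjectiveModNGaloisRep_pow_of_unipotent`, every `p`) gives surj(p²), and Serre's inductive step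
(`forall_hasSurjectiveModNGaloisRep_of_hasSurjectiveModNGaloisRep_sq`, `p` odd) the tower.
[cite: Kato2004Asterisque, Thm. 13.4 (3) (p. 226); (12.5.2) in Thm. 12.5 (4) (p. 222)]
[cite: SerreAbelianLadic1968, Ch. IV §3.4, Lemma 3] -/
theorem forall_hasSurjectiveModNGaloisRep_pow_of_surj_of_bigIm (hp2 : p ≠ 2) (hs : Surj W p)
    (him : BigIm W p) : ∀ n : ℕ, W.HasSurjectiveModNGaloisRep (p ^ n : ℕ) := by
  have hpP : p.Prime := hp.out
  obtain ⟨σ, hσζ, ⟨Ψ⟩⟩ := him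
  have hσ : ∀ (n : ℕ) (t : AlgebraicClosure ℚ), t ^ p ^ n = 1 → σ • t = t := by
    intro n t ht
    rw [absoluteGaloisGroup.smul_def]
    exact hσζ t n ht
  apply forall_hasSurjectiveModNGaloisRep_of_hasSurjectiveModNGaloisRep_sq W p hp2
  -- the second projection `π₂ : T_pE → E[p²]`, `Γ_ℚ`-equivariant
  set π₂ : W.tateModule p →+ geomTorsion W ((p ^ 2 : ℕ) : ℤ) :=
    (TateModule.proj p 2).codRestrict (geomTorsion W ((p ^ 2 : ℕ) : ℤ))
      (proj_tateModule_mem_geomTorsion W p 2) with hπ₂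
  have hπ₂val : ∀ a, (π₂ a : geomPoints W) = TateModule.proj p 2 a := fun a => rfl
  have hπ₂smul : ∀ a, π₂ (σ • a) = σ • π₂ a := fun a => Subtype.ext rfl
  refine hasSurjectiveModNGaloisRep_pow_of_unipotent W p hs 2 ⟨σ, ?_, ?_⟩
  · -- `(σ - 1)² = 0` on `E[p²]`
    intro P
    obtain ⟨a, ha⟩ := proj_surjective_of_isAlgClosed_holds W p 2 P.2
    have hPa : P = π₂ a := Subtype.ext ha.symm
    rw [hPa, ← hπ₂smul, ← map_sub, ← hπ₂smul, smul_smul_sub_eq_of_bigImWitness W p σ hσ Ψ a]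
  · -- a point of order `p` in `E[p²]` moved by `σ`
    obtain ⟨P₁, hP₁⟩ := exists_torsion_smul_ne_of_bigImWitness W p σ Ψ
    have hP₁mem : (P₁ : geomPoints W) ∈ geomTorsion W (p ^ 1 : ℕ) := by rw [pow_one]; exact P₁.2
    obtain ⟨w, hw⟩ := proj_surjective_of_isAlgClosed_holds W p 1 hP₁mem
    have hpw : TateModule.proj p 2 (p • w) = (P₁ : geomPoints W) := by
      rw [map_nsmul, show (2 : ℕ) = 1 + 1 from rfl, TateModule.smul_proj_succ, hw]
    refine ⟨π₂ (p • w), ?_, ?_⟩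
    · rw [← map_nsmul, ← mul_nsmul, ← sq]
      apply Subtype.ext
      rw [hπ₂val, ZeroMemClass.coe_zero, map_nsmul, TateModule.pow_smul_proj]
    · intro h
      apply hP₁
      apply Subtype.ext
      have h' := congrArg (Subtype.val : geomTorsion W ((p ^ 2 : ℕ) : ℤ) → geomPoints W) h
      rw [← hπ₂smul, hπ₂val, hπ₂val, TateModule.proj_smul_of_distribMulAction, hpw] at h'
      exact h'

/-- **surj(p) ∧ (im) ⟹ (12.5.2)** (`p` odd): Kato's integrality hypothesis `Kato2004.ImageContainsSL2 W p`
from surj(p) and (im), by `forall_hasSurjectiveModNGaloisRep_pow_of_surj_of_bigIm` and the tree's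
`Kato2004.imageContainsSL2_of_forall_hasSurjectiveModNGaloisRep`.
[cite: Kato2004Asterisque, (12.5.2) in Thm. 12.5 (4) (p. 222); Thm. 13.4 (3) (p. 226)] -/
theorem imageContainsSL2_of_surj_of_bigIm (hp2 : p ≠ 2) (hs : Surj W p) (him : BigIm W p) :
    Kato2004.ImageContainsSL2 W p :=
  Kato2004.imageContainsSL2_of_forall_hasSurjectiveModNGaloisRep W p
    (forall_hasSurjectiveModNGaloisRep_pow_of_surj_of_bigIm W p hp2 hs him)

/-- **Under surj(p), `p` odd: (im) ⟺ (12.5.2).** The hypothesis of Kato's Thm. 13.4 (3) / BCS (im) /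
Skinner 2016 §2.5 (b) and Kato's (12.5.2) coincide for an elliptic curve over `ℚ` with surjective
mod-`p` image; `⇐` is the tree's `Kato2004.exists_quotient_range_sub_one_equiv_of_imageContainsSL2`
(no surjectivity needed). The content is at `p = 3`: for `p ≥ 5` both sides follow from surj(p)
(Serre). [cite: Kato2004Asterisque, (12.5.2) in Thm. 12.5 (4) (p. 222); Thm. 13.4 (3) (p. 226)]
[cite: BurungaleCastellaSkinner2025, hypothesis (im)] -/
theorem bigIm_iff_imageContainsSL2_of_surj (hp2 : p ≠ 2) (hs : Surj W p) :
    BigIm W p ↔ Kato2004.ImageContainsSL2 W p := by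
  refine ⟨imageContainsSL2_of_surj_of_bigIm W p hp2 hs, fun h => ?_⟩
  obtain ⟨σ, hσ, hΨ⟩ := Kato2004.exists_quotient_range_sub_one_equiv_of_imageContainsSL2 W p h
  refine ⟨σ, fun ζ n hζ => ?_, ?_⟩
  · rw [← absoluteGaloisGroup.smul_def]
    exact hσ n ζ hζ
  · simpa only [Module.End.one_eq_id] using hΨ

/-- **EXOTIC rows: surj(3) ∧ ¬surj(9) ⟹ ¬(im).** For `E = W/ℚ` with `ρ̄_{E,3}` onto and `ρ̄_{E,9}`
not onto (Elkies' 9-deficient `3`-adic image — the EXOTIC residue of N11), hypothesis (im) at `3`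
(`BigIm W 3` = Kato 2004 Thm. 13.4 (3) = BCS 2025 (im) = Skinner 2016 §2.5 (b) = Rubin / Kim–Nakamura
2020 `Hyp(ℚ, T₃E)` (a)) FAILS: no Euler/Kolyvagin-system integrality clause in print applies to such a
pair, not even after weakening Kato's (12.5.2). [cite: Kato2004Asterisque, Thm. 13.4 (3) (p. 226)]
[cite: BurungaleCastellaSkinner2025, hypothesis (im)] [cite: KimNakamura2020, Assumption 4.1 and Thm. 4.2] -/
theorem not_bigIm_of_surj_three_of_not_surj_nine (hs : Surj W 3)
    (h9 : ¬ W.HasSurjectiveModNGaloisRep 9) : ¬ BigIm W 3 := by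
  haveI : Fact (Nat.Prime 3) := ⟨Nat.prime_three⟩
  intro him
  apply h9
  have h := forall_hasSurjectiveModNGaloisRep_pow_of_surj_of_bigIm W 3 (by norm_num) hs him 2
  norm_num at h
  exact h

/-- **EXOTIC rows in the residue's own binder shape**: surj(3) ∧ ¬(∀ n, `ρ̄_{E,3^n}` onto) ⟹ ¬(im).
(The EXOTIC clause of `Additive.x4SharpThree_iff_residue_sharp` /
`x4SharpUnitFree_iff_lower_and_residues_sharp` is `¬ ∀ n, W.HasSurjectiveModNGaloisRep (3^n)`.)
[cite: Kato2004Asterisque, Thm. 13.4 (3) (p. 226)] [cite: BurungaleCastellaSkinner2025, hypothesis (im)] -/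
theorem not_bigIm_of_surj_three_of_not_towerSurj (hs : Surj W 3)
    (h : ¬ ∀ n : ℕ, W.HasSurjectiveModNGaloisRep (3 ^ n : ℕ)) : ¬ BigIm W 3 := by
  haveI : Fact (Nat.Prime 3) := ⟨Nat.prime_three⟩
  exact fun him => h (forall_hasSurjectiveModNGaloisRep_pow_of_surj_of_bigIm W 3 (by norm_num) hs him)

/-- **EXOTIC rows fail Kato's (12.5.2)** (the sub-target's literal ask; the tree one-liner
`Kato2004.not_imageContainsSL2_of_not_hasSurjectiveModNGaloisRep`, restated at `3` in the residue's
binder shape). [cite: Kato2004Asterisque, (12.5.2) in Thm. 12.5 (4) (p. 222)] -/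
theorem not_imageContainsSL2_three_of_not_towerSurj
    (h : ¬ ∀ n : ℕ, W.HasSurjectiveModNGaloisRep (3 ^ n : ℕ)) : ¬ Kato2004.ImageContainsSL2 W 3 := by
  haveI : Fact (Nat.Prime 3) := ⟨Nat.prime_three⟩
  exact fun hSL => h (Kato2004.forall_hasSurjectiveModNGaloisRep_of_imageContainsSL2 W 3 hSL)

/-- **EXOTIC ⟺ surj(3) ∧ ¬(im)**, on the surj(3) rows: the EXOTIC clause `¬ ∀ n, ρ̄_{E,3^n} onto`
of the N11 residue theorems is EQUIVALENT to the failure of (im) at `3`. So the EXOTIC residue is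
exactly "surj(3) but no Kolyvagin-system `σ`". [cite: Kato2004Asterisque, Thm. 13.4 (3) (p. 226)]
[cite: BurungaleCastellaSkinner2025, hypothesis (im)] -/
theorem not_towerSurj_three_iff_not_bigIm_of_surj (hs : Surj W 3) :
    (¬ ∀ n : ℕ, W.HasSurjectiveModNGaloisRep (3 ^ n : ℕ)) ↔ ¬ BigIm W 3 := by
  haveI : Fact (Nat.Prime 3) := ⟨Nat.prime_three⟩
  refine ⟨not_bigIm_of_surj_three_of_not_towerSurj W hs, fun hn htower => hn ?_⟩
  exact (bigIm_iff_imageContainsSL2_of_surj W 3 (by norm_num) hs).mpr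
    (Kato2004.imageContainsSL2_of_forall_hasSurjectiveModNGaloisRep W 3 htower)

/-! ### Appendix (referee 1, ACK-1 T-a5 proviso (1)): the exact binders of the lifting lemma used,
and that it carries NO `5 ≤ p`

The ONE tree theorem on which `forall_hasSurjectiveModNGaloisRep_pow_of_surj_of_bigIm` rests for the
step "unipotent witness on `E[p²]` ⟹ surj(p²)" is
`Literature.NumberTheory.EllipticCurves.hasSurjectiveModNGaloisRep_pow_of_unipotent`
(`BSDSelmerPConverseUnipotentProofs.lean` l. 76), whose binders are VERBATIM:
`(W : WeierstrassCurve ℚ) [W.IsElliptic] (p : ℕ) [Fact p.Prime] (hsurj : W.HasSurjectiveModNGaloisRep p)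
(n : ℕ) (hu : ∃ σ : Field.absoluteGaloisGroup ℚ, (∀ P : geomTorsion W ((p ^ n : ℕ) : ℤ),
σ • (σ • P - P) = σ • P - P) ∧ ∃ Q : geomTorsion W ((p ^ n : ℕ) : ℤ), p • Q = 0 ∧ σ • Q ≠ Q)`, conclusion
`W.HasSurjectiveModNGaloisRep (p ^ n : ℕ)` — EVERY prime `p` (its docstring: "for every prime `p` …
the transvection form of Serre's lifting lemma (`TransvectionLifting.generalLinearGroup_eq_top_of_unipotent_mem`),
which needs no hypothesis on `p`"). There is no `5 ≤ p` (nor `p ≠ 2`) anywhere in it; the only parity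
hypothesis of this file, `p ≠ 2`, enters through Serre's INDUCTIVE step
`forall_hasSurjectiveModNGaloisRep_of_hasSurjectiveModNGaloisRep_sq` (surj(p²) ⟹ tower, `p` odd). The
theorem below instantiates the lifting lemma at `p = 3`, `n = 2` with its binders displayed, so that the
kernel re-checks the quoted shape. -/

/-- **The lifting lemma at `p = 3`, level `9`, binders displayed** (referee 1, ACK-1 T-a5 proviso (1)):
surj(3) and ONE `σ ∈ Γ_ℚ` acting on `E[9]` with `(σ − 1)² = 0` and moving a point killed by `3` give
surj(9) — the tree's `hasSurjectiveModNGaloisRep_pow_of_unipotent` at `p = 3`, `n = 2`, which has NO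
`5 ≤ p` hypothesis. [cite: SerreAbelianLadic1968, Ch. IV §3.4, Lemma 3] -/
theorem hasSurjectiveModNGaloisRep_nine_of_surj_three_of_unipotent (hs : Surj W 3)
    (hu : ∃ σ : absoluteGaloisGroup ℚ,
      (∀ P : geomTorsion W ((3 ^ 2 : ℕ) : ℤ), σ • (σ • P - P) = σ • P - P) ∧
        ∃ Q : geomTorsion W ((3 ^ 2 : ℕ) : ℤ), 3 • Q = 0 ∧ σ • Q ≠ Q) :
    W.HasSurjectiveModNGaloisRep 9 := by
  haveI : Fact (Nat.Prime 3) := ⟨Nat.prime_three⟩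
  have h := hasSurjectiveModNGaloisRep_pow_of_unipotent W 3 hs 2 hu
  norm_num at h
  exact h

end Summit.BirchSwinnertonDyer.Rank1Residual.GaloisImage

end
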